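import Mathlib
import HarnessLib
import Summits.Ventures.LatticeQCDFlow.Exactness.LeapfrogHMCDoeblin
import Summits.Ventures.LatticeQCDFlow.Exactness.U1ExpChartMinorisation
import Summits.Ventures.LatticeQCDFlow.Exactness.StdGaussianRadial
import Summits.Ventures.LatticeQCDFlow.Exactness.Phi4LeapfrogPerm

/-!
# Single-step leapfrog HMC on `SU(2)` lattice gauge fields, as the engine runs it: the kernel and its exactness

HONEST FRAMING: exact (Metropolis-corrected) sampling algorithms for lattice gauge theory;
figures of merit are autocorrelation/cost numbers at stated couplings and volumes; no
continuum-physics claim.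

Venture `LatticeQCDFlow` (cell pub-lqcd), topic `Exactness`, FANOUT row 9 (eng-latcore, the
engine `latflow.core.hmc.HMC(f, β, 'leapfrog')` on `SU(2)`, `trajectory(τ, nstep = 1)`).  NEW
WORK of the cell over Mathlib and the tree (`LeapfrogHMCDoeblin.lean`, `U1ExpChartMinorisation.lean`,
`MomentumRefresh.hmc_config_exact`, `SplittingIntegrator.lean` / `SplittingWords.lean`,
`StdGaussianRadial.lintegral_prod_pi`); nothing here is cited as a fact.  Printed counterparts,
named only: Duane–Kennedy–Pendleton–Roweth 1987, Kennedy–Pendleton / Gottlieb et al. 1987 (the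
gauge-link leapfrog `U ← e^{εP} U`).

THE ENGINE'S UPDATE, TYPED CONCRETELY (this file = part 1: the objects and exactness; part 2,
`U1LeapfrogHMCErgodic.lean` = Doeblin and uniform ergodicity).  Links `U : ι → SU(2)` (any finite
link set `ι`), momenta `P_l = i p_l·σ ∈ 𝔰𝔲(2)` in Pauli coordinates `p : ι → ℝ³`
(`random_algebra` / `lc_momenta` draw `p_l ∼ N(0, ¼·1₃)`, density `∝ e^{−2|p_l|²} = e^{tr P_l²}`; here
any `κ > 0`, `T_κ(p) = κ Σ_l |p_l|²`), ONE P-first leapfrog step `P ← P + g(U)`, `U_l ← exp(iε p_l·σ) U_l`,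
`P ← P + g(U)` with ANY measurable momentum increment `g` (in the engine `−½ε ∂S`; its accuracy is
irrelevant to everything below), the momentum flip, the Metropolis test on `H = S(U) + T_κ(p)`,
forget the momenta:

* `u1ExpDrift` (`u1ExpDrift_neg`: `e_ε(−p) = e_ε(p)⁻¹`, `Circle.exp_neg`), `u1Kinetic`,
  `u1MomentumWeight` / `u1MomentumLaw` = `Z⁻¹ e^{−T_κ} dp` with **`u1MomentumWeight_univ`**:
  `Z = (√(π/κ))^{|ι|}` (Mathlib's `integral_gaussian`, Tonelli over the links), hence
  `0 < Z < ∞` and `u1MomentumLaw` is a probability law;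
* `u1LeapfrogProposal ε g = flip ∘ K(g) D(e_ε) K(g)` — measurable, an involution
  (`involutive_u1LeapfrogProposal`), Liouville for `Haar^{⊗ι} ⊗ Lebesgue`
  (`measurePreserving_u1LeapfrogProposal`; row 2's `isNegInvariant_volume_pi`);
* **`u1LeapfrogHMC ε κ hg S`** — THE CONFIGURATION KERNEL, literally the tree's
  `refreshUpdate (involMH (u1LeapfrogProposal ε g) _ (S + T_κ)) (u1MomentumLaw κ)`;
  `u1GibbsLaw S = Z_S⁻¹ e^{−S} · Haar^{⊗ι}`;
* **`u1LeapfrogHMC_invariant`** — EXACTNESS: the kernel leaves `e^{−S} · Haar^{⊗ι}` invariant for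
  every measurable `S`, every `ε`, every `κ > 0`, every measurable `g` (`hmc_config_exact`).

NOT CLAIMED here: anything about rates or ergodicity (part 2); `nstep ≥ 2` / OMF words (exact by
`SplittingWords.lean`, not re-instantiated); `SU(N ≥ 3)`; floating point; the identification
`κ = 2` with the engine's matrix momenta is the dictionary of `GaussianProjection.lean` /
`SUNGeneratorSum.lean`, not re-derived.
-/

noncomputable section

namespace Summit.Ventures.LatticeQCDFlow.Exactness

open MeasureTheory ProbabilityTheory ProbabilityTheory.Kernel Set Metric
open Literature.MathematicalPhysics.QuantumFieldTheory (haarProbability)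
open scoped ENNReal

variable {ι : Type*}

/-! ## §1 The engine's single-step leapfrog HMC on `SU(2)^ι`, and its exactness -/

section Defs

/-- **The link drift factors** `e_ε(p)_l = exp(iε p_l·σ) ∈ SU(2)` (the engine's `U ← expm(ε P) U`
with `P_l = i p_l·σ` in Pauli coordinates). -/
def u1ExpDrift (ε : ℝ) (p : ι → ℝ) : ι → Circle :=
  fun l => Circle.exp (ε * p l)

/-- The drift factor at a link. -/
@[simp] theorem u1ExpDrift_apply (ε : ℝ) (p : ι → ℝ) (l : ι) :
    u1ExpDrift ε p l = Circle.exp (ε * p l) := rfl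

/-- Time reversal of the drift: `e_ε(−p) = e_ε(p)⁻¹`. -/
theorem u1ExpDrift_neg (ε : ℝ) (p : ι → ℝ) :
    u1ExpDrift ε (-p) = (u1ExpDrift ε p)⁻¹ := by
  funext l
  simp only [u1ExpDrift, Pi.neg_apply, Pi.inv_apply, mul_neg, Circle.exp_neg]

/-- The drift factors depend measurably on the momenta. -/
theorem measurable_u1ExpDrift (ε : ℝ) :
    Measurable (u1ExpDrift (ι := ι) ε) :=
  measurable_pi_lambda _ fun l =>
    Circle.exp.continuous.measurable.comp (measurable_const.mul (measurable_pi_apply l))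

variable [Fintype ι]

/-- **The kinetic term** `T_κ(p) = κ Σ_l |p_l|²` (the engine's `−tr P² = 2|p|²`, `κ = 2`). -/
def u1Kinetic (κ : ℝ) (p : ι → ℝ) : ℝ := κ * ∑ l, ‖p l‖ ^ 2

/-- The kinetic term is continuous. -/
theorem continuous_u1Kinetic (κ : ℝ) : Continuous (u1Kinetic (ι := ι) κ) :=
  continuous_const.mul (continuous_finsetSum _ fun l _ => ((continuous_apply l).norm).pow 2)

/-- The kinetic term is measurable. -/
theorem measurable_u1Kinetic (κ : ℝ) : Measurable (u1Kinetic (ι := ι) κ) :=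
  (continuous_u1Kinetic κ).measurable

/-- The kinetic term is non-negative for `κ ≥ 0`. -/
theorem u1Kinetic_nonneg {κ : ℝ} (hκ : 0 ≤ κ) (p : ι → ℝ) :
    0 ≤ u1Kinetic κ p :=
  mul_nonneg hκ (Finset.sum_nonneg fun _ _ => sq_nonneg _)

/-- The kinetic term is even. -/
theorem u1Kinetic_neg (κ : ℝ) (p : ι → ℝ) :
    u1Kinetic κ (-p) = u1Kinetic κ p := by
  simp [u1Kinetic]

/-- In a box `|p_l| ≤ R` the kinetic term is at most `κ |ι| R²`. -/
theorem u1Kinetic_le_of_norm_le {κ : ℝ} (hκ : 0 ≤ κ) {R : ℝ} {p : ι → ℝ}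
    (hp : ∀ l, ‖p l‖ ≤ R) : u1Kinetic κ p ≤ κ * (Fintype.card ι * R ^ 2) := by
  unfold u1Kinetic
  refine mul_le_mul_of_nonneg_left ?_ hκ
  calc ∑ l, ‖p l‖ ^ 2 ≤ ∑ _l : ι, R ^ 2 :=
        Finset.sum_le_sum fun l _ => pow_le_pow_left₀ (norm_nonneg _) (hp l) 2
    _ = Fintype.card ι * R ^ 2 := by rw [Finset.sum_const, Finset.card_univ, nsmul_eq_mul]

/-- **The un-normalised momentum weight** `e^{−T_κ(p)} dp` (Lebesgue measure on `(ℝ³)^ι`). -/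
def u1MomentumWeight (κ : ℝ) : Measure (ι → ℝ) :=
  volume.withDensity fun p => ENNReal.ofReal (Real.exp (-u1Kinetic κ p))

/-- **The momentum refresh law** `Z⁻¹ e^{−T_κ(p)} dp` (independent centred Gaussians,
`p_l ∼ N(0, (2κ)⁻¹·1₃)`). -/
def u1MomentumLaw (κ : ℝ) : Measure (ι → ℝ) :=
  (u1MomentumWeight (ι := ι) κ univ)⁻¹ • u1MomentumWeight κ

/-- The one-link Gaussian integral: `∫_ℝ e^{−κθ²} dθ = √(π/κ)` (Mathlib's `integral_gaussian`), as
a lower Lebesgue integral. -/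
theorem lintegral_exp_neg_mul_sq_norm_real {κ : ℝ} (hκ : 0 < κ) :
    ∫⁻ v : ℝ, ENNReal.ofReal (Real.exp (-κ * ‖v‖ ^ 2)) = ENNReal.ofReal (Real.sqrt (Real.pi / κ)) := by
  have hnorm : (fun v : ℝ => Real.exp (-κ * ‖v‖ ^ 2)) = fun v => Real.exp (-κ * v ^ 2) := by
    funext v
    rw [Real.norm_eq_abs, sq_abs]
  have hval : ∫ v : ℝ, Real.exp (-κ * ‖v‖ ^ 2) = Real.sqrt (Real.pi / κ) := by
    rw [hnorm, integral_gaussian]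
  have hpos : (0 : ℝ) < Real.sqrt (Real.pi / κ) := Real.sqrt_pos.2 (by positivity)
  have hint : Integrable (fun v : ℝ => Real.exp (-κ * ‖v‖ ^ 2)) := by
    by_contra h
    have h0 := integral_undef h
    rw [hval] at h0
    exact hpos.ne' h0
  rw [← ofReal_integral_eq_lintegral_ofReal hint (Filter.Eventually.of_forall fun v => (Real.exp_pos _).le),
    hval]

/-- **`Z = (√(π/κ))^{|ι|}`**: the momentum weight factorises over the links (Tonelli,
`StdGaussianRadial.lintegral_prod_pi`). -/
theorem u1MomentumWeight_univ {κ : ℝ} (hκ : 0 < κ) :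
    u1MomentumWeight (ι := ι) κ univ = ENNReal.ofReal (Real.sqrt (Real.pi / κ)) ^ Fintype.card ι := by
  have hmeas1 : Measurable fun v : ℝ => ENNReal.ofReal (Real.exp (-κ * ‖v‖ ^ 2)) :=
    (Real.measurable_exp.comp (measurable_const.mul (measurable_norm.pow_const 2))).ennreal_ofReal
  have h1 : ∀ p : ι → ℝ, ENNReal.ofReal (Real.exp (-u1Kinetic κ p)) =
      ∏ l, ENNReal.ofReal (Real.exp (-κ * ‖p l‖ ^ 2)) := by
    intro p
    rw [← ENNReal.ofReal_prod_of_nonneg (fun l _ => (Real.exp_pos _).le), ← Real.exp_sum]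
    congr 2
    rw [u1Kinetic, Finset.mul_sum Finset.univ (fun l => ‖p l‖ ^ 2) κ, ← Finset.sum_neg_distrib]
    exact Finset.sum_congr rfl fun l _ => by ring
  rw [u1MomentumWeight, withDensity_apply _ MeasurableSet.univ, Measure.restrict_univ, volume_pi]
  simp_rw [h1]
  rw [lintegral_prod_pi (fun _ : ι => (volume : Measure (ℝ))) (fun _ => hmeas1),
    Finset.prod_const, Finset.card_univ, lintegral_exp_neg_mul_sq_norm_real hκ]

/-- `Z ≠ 0`. -/
theorem u1MomentumWeight_univ_ne_zero {κ : ℝ} (hκ : 0 < κ) : u1MomentumWeight (ι := ι) κ univ ≠ 0 := by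
  rw [u1MomentumWeight_univ hκ]
  refine pow_ne_zero _ ?_
  rw [Ne, ENNReal.ofReal_eq_zero, not_le]
  exact Real.sqrt_pos.2 (by positivity)

/-- `Z ≠ ∞`. -/
theorem u1MomentumWeight_univ_ne_top {κ : ℝ} (hκ : 0 < κ) : u1MomentumWeight (ι := ι) κ univ ≠ ⊤ := by
  rw [u1MomentumWeight_univ hκ]
  exact ENNReal.pow_ne_top ENNReal.ofReal_ne_top

/-- The momentum refresh law is a probability law. -/
instance isProbabilityMeasure_u1MomentumLaw {κ : ℝ} [hκ : Fact (0 < κ)] :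
    IsProbabilityMeasure (u1MomentumLaw (ι := ι) κ) :=
  ⟨by rw [u1MomentumLaw, Measure.smul_apply, smul_eq_mul,
    ENNReal.inv_mul_cancel (u1MomentumWeight_univ_ne_zero hκ.out) (u1MomentumWeight_univ_ne_top hκ.out)]⟩

variable (ε : ℝ) (g : (ι → Circle) → ι → ℝ)

/-- **The proposal map**: ONE P-first leapfrog step `K(g) D(e_ε) K(g)` followed by the momentum flip
(`g` = the momentum increment of a half kick, in the engine `−½ε ∂S`). -/
def u1LeapfrogProposal :
    Equiv.Perm ((ι → Circle) × (ι → ℝ)) :=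
  flip * palindromicWord [kick g] (drift (mulDrift (u1ExpDrift ε))) ^ 1

variable {g}

omit [Fintype ι] in
/-- The proposal map is measurable (for measurable `g`). -/
theorem measurable_u1LeapfrogProposal (hg : Measurable g) : Measurable (⇑(u1LeapfrogProposal ε g)) := by
  rw [u1LeapfrogProposal, pow_one, palindromicWord_kick_drift, Equiv.Perm.coe_mul, Equiv.Perm.coe_mul,
    Equiv.Perm.coe_mul]
  exact measurable_flip.comp ((measurable_kick hg).comp
    ((measurable_drift (measurable_mulDrift (measurable_u1ExpDrift ε))).comp (measurable_kick hg)))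

omit [Fintype ι] in
/-- The proposal map is an involution (time reversal of the palindromic word). -/
theorem involutive_u1LeapfrogProposal : Function.Involutive (⇑(u1LeapfrogProposal ε g)) :=
  (palindromicWord_pow_isFlipReversible flip_mul_flip
    (drift_isFlipReversible (mulDrift_reversal (u1ExpDrift_neg ε)))
    (fun A hA => by rw [List.mem_singleton] at hA; subst hA; exact kick_isFlipReversible g) 1).involutive

/-- The proposal map preserves `Haar^{⊗ι} ⊗ Lebesgue` (Liouville). -/
theorem measurePreserving_u1LeapfrogProposal (hg : Measurable g) :
    MeasurePreserving (⇑(u1LeapfrogProposal ε g))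
      ((Measure.pi fun _ : ι => haarProbability (Circle)).prod volume)
      ((Measure.pi fun _ : ι => haarProbability (Circle)).prod volume) := by
  haveI := isNegInvariant_volume_pi (Λ := ι)
  rw [u1LeapfrogProposal, Equiv.Perm.coe_mul]
  exact measurePreserving_flip.comp (measurePreserving_perm_pow
    (measurePreserving_palindromicWord
      (measurePreserving_drift (measurable_mulDrift (measurable_u1ExpDrift ε))
        (measurePreserving_mulDrift (u1ExpDrift ε)))
      (fun A hA => by rw [List.mem_singleton] at hA; subst hA; exact measurePreserving_kick hg)) 1)

variable (κ : ℝ)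

/-- **THE ENGINE'S CONFIGURATION KERNEL** (`hmc.HMC(f, β, 'leapfrog').trajectory(τ = ε, nstep = 1)`):
refresh `p ∼ Z⁻¹e^{−T_κ}`, one P-first leapfrog step, flip, Metropolis test on `S + T_κ`, forget `p`. -/
def u1LeapfrogHMC (hg : Measurable g) (S : (ι → Circle) → ℝ) :
    Kernel (ι → Circle) (ι → Circle) :=
  refreshUpdate
    (involMH (⇑(u1LeapfrogProposal ε g)) (measurable_u1LeapfrogProposal ε hg)
      fun z => S z.1 + u1Kinetic κ z.2)
    (u1MomentumLaw κ)

/-- **The Gibbs law** `π_S = Z_S⁻¹ e^{−S} · Haar^{⊗ι}` (for the Wilson action: the torus Wilson measure). -/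
def u1GibbsLaw (S : (ι → Circle) → ℝ) :
    Measure (ι → Circle) :=
  (((Measure.pi fun _ : ι => haarProbability (Circle)).withDensity
      fun u => ENNReal.ofReal (Real.exp (-S u))) univ)⁻¹ •
    (Measure.pi fun _ : ι => haarProbability (Circle)).withDensity
      fun u => ENNReal.ofReal (Real.exp (-S u))

variable {ε κ}

/-- **Exactness**: the kernel leaves `e^{−S} · Haar^{⊗ι}` invariant (`hmc_config_exact` with the
Liouville and time-reversal facts above), for every measurable `S`, every `ε`, every `κ > 0`. -/
theorem u1LeapfrogHMC_invariant (hκ : 0 < κ) (hg : Measurable g)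
    {S : (ι → Circle) → ℝ} (hS : Measurable S) :
    Invariant (u1LeapfrogHMC ε κ hg S)
      ((Measure.pi fun _ : ι => haarProbability (Circle)).withDensity
        fun u => ENNReal.ofReal (Real.exp (-S u))) :=
  hmc_config_exact (vol := Measure.pi fun _ : ι => haarProbability (Circle))
    (volP := volume) (hΦ := measurable_u1LeapfrogProposal ε hg) hS (measurable_u1Kinetic κ)
    (involutive_u1LeapfrogProposal ε) (measurePreserving_u1LeapfrogProposal ε hg)
    (u1MomentumWeight_univ_ne_zero hκ) (u1MomentumWeight_univ_ne_top hκ)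

end Defs

end Summit.Ventures.LatticeQCDFlow.Exactness
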